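import Summits.ResolutionOfSingularities.ResolutionOfSingularities.Theorems.FrobeniusLadderFInjectiveMacaulayficationRegularOffCodimFourResidue
import Summits.ResolutionOfSingularities.ResolutionOfSingularities.Theorems.FrobeniusLadderFInjectiveMacaulayficationClosedPointsOfClosedFinite
import HarnessLib

/-!
# THEOREM A «TERMINATION MODULO CLOSED POINTS» on fourfolds: a blowing up supported in `Sing X` that is REGULAR off FINITELY MANY CLOSED
# POINTS (crux `FInjectiveMacaulayfication` stmt-ResolutionOfSingularities-15315, chain w45a; res-L1-w45a-lead-1 PROPOSAL 22:54:15Z, res-L1-w45a-plan-1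
# RULINGS R16.59/R16.60 «file 3 `…TerminationModClosedPoints` = stub-3»; seat res-L1-w45a-stub-3 g7)

[OURS · L1 W4.5a] Support file (`--supports stmt-ResolutionOfSingularities-15315 --as helper`); NOT a statement of any manuscript; def-free;
a THEOREM modulo the three printed results of the tree's threefold package BY NAME (`CossartPiltant2019General` = CP 2019 Thm. 1.1 (i)(ii),
`Stacks081R` = Raynaud–Gruson 5.2.2, `CossartPiltant2019Principalization` = CP 2019 Prop. 4.4); AI-written (AI review is weaker than expert review).

THE POINT. The Noetherian induction the chain planned as «files 1–3» (spread from the local scheme, one resolution round at a point of local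
dimension three, induction on the bad set) IS ALREADY IN THE TREE: `RegularOffCodimFourResidue.exists_isBlowup_regular_off_codimFour`
(this seat, gen 5, p557070 — Temkin 2008 Prop. 2.3.4 truncated at codimension `4`, the local input being Cossart–Piltant at points of local
dimension `3`): every integral finite-type `X/k` with `dim X ≥ 3` has a blowing up `f : X' → X` along `J` with `Supp J ⊆ Sing X`, regular off
`f⁻¹(B)` for a CLOSED set `B` all of whose points have local dimension `≥ 4`. On a FOURFOLD such points are CLOSED points (dimension formula
`dim 𝒪_{X,x} + dim closure {x} = dim X`, `isClosed_singleton_of_le_ringKrullDim_stalk`), and a closed set of closed points of a Noetherian scheme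
is finite (`ClosedPointsOfClosedFinite`) — whence
* §1 `isClosed_singleton_iff_height_eq_zero`, `exists_ringKrullDim_stalk_add_height_eq`, `isClosed_singleton_of_le_ringKrullDim_stalk`,
  `ringKrullDim_stalk_le_of_not_isClosed`, and **I-C `exists_mem_ringKrullDim_eq_three`** (res-L1-w45a-lead-1's interface `hpt` of
  `DesingularizationOffClosedPoints.desingularization_offClosedPoints_of_local`: a closed set of a fourfold with a non-closed point contains a
  point of local dimension `3`) + the any-`d` form `exists_mem_ringKrullDim_eq_pred`;
* §2 **`exists_isBlowup_regular_off_finite_closedPoints (hG h081R hP) (f₀ : X ⟶ Spec k) (h4 : topologicalKrullDim X = 4)`**: a blowing up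
  `f : X' → X` along `J ≠ ⊥`, `Supp J ⊆ (Reg X)ᶜ`, and a FINITE set `F` of CLOSED points with `X'` regular at every point not over `F`.
Consequence drawn by res-L1-w45a-lead-1 (file 4): on fourfolds the door stub FC″(loc dim ≤ 3) reduces to closed-point absorption (T3ᵃ′).
[folklore assembly; cite: Temkin2008, Prop. 2.3.4] [cite: CossartPiltant2019, Thm. 1.1 (i)(ii); Prop. 4.4] [cite: GortzWedhorn2020, Thm. 5.22]
-/

-- single-problem summit: the doubled namespace component is forced
set_option linter.dupNamespace false

noncomputable section

namespace Summit.ResolutionOfSingularities.ResolutionOfSingularities.Theorems.FInjectiveMacaulayfication.TerminationModClosedPoints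

open CategoryTheory AlgebraicGeometry TopologicalSpace Order
open Literature.AlgebraicGeometry.Resolution
open Summit.ResolutionOfSingularities.ResolutionOfSingularities.Theorems.FInjectiveMacaulayfication

/-! ## §1 Closed points, the dimension formula, and points of local dimension three -/

/-- In a scheme, **`{x}` is closed iff `x` has height `0` in the specialisation order** (no proper specialisation; schemes are `T₀`).
[folklore] -/
theorem isClosed_singleton_iff_height_eq_zero {Y : Scheme.{0}} (x : Y) : IsClosed ({x} : Set Y) ↔ height x = 0 := by
  constructor
  · intro hcl
    rw [Order.height_eq_zero]
    intro y hy
    -- `y ≤ x` means `x ⤳ y`, i.e. `y ∈ closure {x} = {x}`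
    have hxy : x ⤳ y := Scheme.le_iff_specializes.1 hy
    have hy' : y ∈ ({x} : Set Y) := hcl.closure_eq ▸ specializes_iff_mem_closure.1 hxy
    rw [Set.mem_singleton_iff.mp hy']
  · intro hh
    have hmin : IsMin x := Order.height_eq_zero.1 hh
    have hcl : closure ({x} : Set Y) = {x} := by
      refine Set.Subset.antisymm (fun y hy => ?_) subset_closure
      have hxy : x ⤳ y := specializes_iff_mem_closure.2 hy
      have hyx : y ⤳ x := Scheme.le_iff_specializes.1 (hmin (Scheme.le_iff_specializes.2 hxy))
      exact (hyx.antisymm hxy).eq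
    rw [← hcl]
    exact isClosed_closure

/-- **The dimension formula in coordinates**: for `X` integral, locally of finite type over a field, of dimension `d`, every point `x` has
`dim 𝒪_{X,x} = e` and `height x = h` with `e + h = d` (`e, h` finite). [cite: GortzWedhorn2020, Thm. 5.22] -/
theorem exists_ringKrullDim_stalk_add_height_eq {K : Type} [Field K] {X : Scheme.{0}} [IsIntegral X] (f : X ⟶ Spec (.of K))
    [LocallyOfFiniteType f] {d : ℕ} (hd : topologicalKrullDim X = d) (x : X) :
    ∃ e h : ℕ, ringKrullDim (X.presheaf.stalk x) = e ∧ height x = h ∧ e + h = d := by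
  have hform := Literature.AlgebraicGeometry.Dimension.coheight_add_height_eq_topologicalKrullDim f x
  rw [hd] at hform
  have hform' : coheight x + height x = d := by exact_mod_cast hform
  have hch : coheight x ≠ ⊤ := by
    intro h
    rw [h, top_add] at hform'
    exact ENat.coe_ne_top d hform'.symm
  have hht : height x ≠ ⊤ := by
    intro h
    rw [h, add_top] at hform'
    exact ENat.coe_ne_top d hform'.symm
  obtain ⟨e, he⟩ := ENat.ne_top_iff_exists.mp hch
  obtain ⟨h, hh⟩ := ENat.ne_top_iff_exists.mp hht
  rw [← he, ← hh] at hform'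
  refine ⟨e, h, ?_, hh.symm, by exact_mod_cast hform'⟩
  rw [ringKrullDim_stalk_eq_coheight, ← he]
  rfl

/-- **A point whose local ring has dimension `≥ dim X` is a closed point** (`X` integral, locally of finite type over a field).
[cite: GortzWedhorn2020, Thm. 5.22] -/
theorem isClosed_singleton_of_le_ringKrullDim_stalk {K : Type} [Field K] {X : Scheme.{0}} [IsIntegral X] (f : X ⟶ Spec (.of K))
    [LocallyOfFiniteType f] {d : ℕ} (hd : topologicalKrullDim X = d) (x : X) (hx : (d : WithBot ℕ∞) ≤ ringKrullDim (X.presheaf.stalk x)) :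
    IsClosed ({x} : Set X) := by
  obtain ⟨e, h, he, hh, hsum⟩ := exists_ringKrullDim_stalk_add_height_eq f hd x
  rw [he] at hx
  have hde : d ≤ e := by exact_mod_cast hx
  have h0 : h = 0 := by omega
  rw [isClosed_singleton_iff_height_eq_zero, hh, h0, ENat.coe_zero]

/-- **A non-closed point of an integral finite-type `d`-fold has local dimension `≤ d - 1`.** [cite: GortzWedhorn2020, Thm. 5.22] -/
theorem ringKrullDim_stalk_le_of_not_isClosed {K : Type} [Field K] {X : Scheme.{0}} [IsIntegral X] (f : X ⟶ Spec (.of K))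
    [LocallyOfFiniteType f] {d : ℕ} (hd : topologicalKrullDim X = d) (x : X) (hx : ¬ IsClosed ({x} : Set X)) :
    ringKrullDim (X.presheaf.stalk x) ≤ (d - 1 : ℕ) := by
  obtain ⟨e, h, he, hh, hsum⟩ := exists_ringKrullDim_stalk_add_height_eq f hd x
  have h0 : h ≠ 0 := by
    intro h0
    apply hx
    rw [isClosed_singleton_iff_height_eq_zero, hh, h0, ENat.coe_zero]
  rw [he]
  exact_mod_cast (by omega : e ≤ d - 1)

/-- **I-C (res-L1-w45a-lead-1's interface, 23:01:12Z): a closed subset of an integral finite-type FOURFOLD containing a non-closed point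
contains a point of local dimension EXACTLY `3`** — the non-closed point `c` has `dim 𝒪_c ≤ 3` and specialises, along a maximal chain, to a
point of local dimension `3` (`RegularOffCodimFourResidue.exists_specializes_ringKrullDim_stalk_eq`, dimension formula), which lies in the
closed `C`. This is the hypothesis `hpt` of `DesingularizationOffClosedPoints.desingularization_offClosedPoints_of_local` on fourfolds.
[cite: GortzWedhorn2020, Thm. 5.22] -/
theorem exists_mem_ringKrullDim_eq_three {K : Type} [Field K] {X : Scheme.{0}} [IsIntegral X] (f : X ⟶ Spec (.of K))
    [LocallyOfFiniteType f] (h4 : topologicalKrullDim X = 4) :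
    ∀ C : Set X, IsClosed C → (∃ c ∈ C, ¬ IsClosed ({c} : Set X)) → ∃ ζ ∈ C, ringKrullDim (X.presheaf.stalk ζ) = 3 := by
  rintro C hC ⟨c, hcC, hncl⟩
  have hc3 : ringKrullDim (X.presheaf.stalk c) ≤ (3 : ℕ) := ringKrullDim_stalk_le_of_not_isClosed f h4 c hncl
  obtain ⟨ζ, hcζ, hζ⟩ := RegularOffCodimFourResidue.exists_specializes_ringKrullDim_stalk_eq f h4 c hc3 (by norm_num)
  exact ⟨ζ, hcζ.mem_closed hC hcC, by rw [hζ]; rfl⟩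

/-- I-C in every dimension `d ≥ 1`: a closed subset of an integral finite-type `d`-fold containing a non-closed point contains a point of
local dimension exactly `d - 1`. [cite: GortzWedhorn2020, Thm. 5.22] -/
theorem exists_mem_ringKrullDim_eq_pred {K : Type} [Field K] {X : Scheme.{0}} [IsIntegral X] (f : X ⟶ Spec (.of K))
    [LocallyOfFiniteType f] {d : ℕ} (hd : topologicalKrullDim X = d) (C : Set X) (hC : IsClosed C)
    (hc : ∃ c ∈ C, ¬ IsClosed ({c} : Set X)) : ∃ ζ ∈ C, ringKrullDim (X.presheaf.stalk ζ) = (d - 1 : ℕ) := by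
  obtain ⟨c, hcC, hncl⟩ := hc
  have hc3 := ringKrullDim_stalk_le_of_not_isClosed f hd c hncl
  obtain ⟨ζ, hcζ, hζ⟩ := RegularOffCodimFourResidue.exists_specializes_ringKrullDim_stalk_eq f hd c hc3 (by omega)
  exact ⟨ζ, hcζ.mem_closed hC hcC, hζ⟩

/-! ## §2 THEOREM A on fourfolds -/

/-- **THEOREM A (termination modulo closed points) on fourfolds.** For every INTEGRAL `X` of finite type over a field `k` with `dim X = 4`
there are a blowing up `f : X' → X` along an ideal sheaf `J ≠ ⊥` with `Supp J ⊆ (Reg X)ᶜ` and a FINITE set `F` of CLOSED points of `X`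
such that `X'` is REGULAR at every point not lying over `F`. (= `RegularOffCodimFourResidue.exists_isBlowup_regular_off_codimFour` + §1 +
`ClosedPointsOfClosedFinite`.) Modulo CP 2019 Thm. 1.1, Raynaud–Gruson 5.2.2, CP 2019 Prop. 4.4 BY NAME. [OURS · conditional-result]
[folklore assembly; cite: Temkin2008, Prop. 2.3.4] [cite: CossartPiltant2019, Thm. 1.1 (i)(ii); Prop. 4.4] -/
theorem exists_isBlowup_regular_off_finite_closedPoints
    (hG : CossartPiltant2019General.{0}) (h081R : Stacks081R.{0}) (hP : CossartPiltant2019Principalization.{0})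
    {k : Type} [Field k] {X : Scheme.{0}} (f₀ : X ⟶ Spec (.of k)) [IsIntegral X] [LocallyOfFiniteType f₀] [QuasiCompact f₀]
    (h4 : topologicalKrullDim X = 4) :
    ∃ (X' : Scheme.{0}) (f : X' ⟶ X) (J : X.IdealSheafData), IsBlowup f J ∧ J ≠ ⊥ ∧
      (J.support : Set X) ⊆ (Scheme.regularLocus X)ᶜ ∧
      ∃ F : Set X, F.Finite ∧ (∀ b ∈ F, IsClosed ({b} : Set X)) ∧
        ∀ x' : X', f x' ∉ F → IsRegularLocalRing (X'.presheaf.stalk x') := by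
  have h3 : (3 : WithBot ℕ∞) ≤ topologicalKrullDim X := by
    rw [h4]
    exact_mod_cast (by norm_num : (3 : ℕ) ≤ 4)
  obtain ⟨X', f, J, hf, hJ, B, hB, hB4, hreg⟩ := RegularOffCodimFourResidue.exists_isBlowup_regular_off_codimFour hG h081R hP f₀ h3
  -- `J ≠ ⊥`: the generic point is regular, hence not in `Supp J`
  have hJne : J ≠ ⊥ := by
    intro h0
    have hgen : genericPoint X ∈ (J.support : Set X) := by rw [h0, Scheme.IdealSheafData.support_bot]; trivial
    have := hJ hgen
    rw [Set.mem_compl_iff, Scheme.mem_regularLocus] at this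
    exact this (inferInstanceAs (IsRegularLocalRing X.functionField))
  -- the points of `B` are closed points, so `B` is finite
  have hBcl : ∀ b ∈ B, IsClosed ({b} : Set X) := fun b hb =>
    isClosed_singleton_of_le_ringKrullDim_stalk f₀ (d := 4) (by rw [h4]; rfl) b (hB4 b hb)
  haveI : IsNoetherian X := ClosedPointsOfClosedFinite.isNoetherian_of_locallyOfFiniteType_of_quasiCompact f₀
  have hBfin : B.Finite := ClosedPointsOfClosedFinite.finite_of_isClosed_of_forall_isClosed_singleton hB hBcl
  exact ⟨X', f, J, hf, hJne, hJ, B, hBfin, hBcl, hreg⟩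

/-- THEOREM A, separated-morphism phrasing (the binders of the crux: `f₀` separated of finite type): the same conclusion.
[OURS · conditional-result] [cite: Temkin2008, Prop. 2.3.4] [cite: CossartPiltant2019, Thm. 1.1 (i)(ii); Prop. 4.4] -/
theorem exists_isBlowup_regular_off_finite_closedPoints'
    (hG : CossartPiltant2019General.{0}) (h081R : Stacks081R.{0}) (hP : CossartPiltant2019Principalization.{0})
    {k : Type} [Field k] {X : Scheme.{0}} (f₀ : X ⟶ Spec (.of k)) [IsIntegral X] [IsSeparated f₀] [LocallyOfFiniteType f₀] [QuasiCompact f₀]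
    (h4 : topologicalKrullDim X = 4) :
    ∃ (X' : Scheme.{0}) (f : X' ⟶ X) (J : X.IdealSheafData), IsBlowup f J ∧ J ≠ ⊥ ∧
      (J.support : Set X) ⊆ (Scheme.regularLocus X)ᶜ ∧ IsIntegral X' ∧ IsProper f ∧
      ∃ F : Set X, F.Finite ∧ (∀ b ∈ F, IsClosed ({b} : Set X)) ∧
        ∀ x' : X', f x' ∉ F → IsRegularLocalRing (X'.presheaf.stalk x') := by
  obtain ⟨X', f, J, hf, hJne, hJ, F, hF, hFcl, hreg⟩ := exists_isBlowup_regular_off_finite_closedPoints hG h081R hP f₀ h4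
  haveI : IsLocallyNoetherian X := LocallyOfFiniteType.isLocallyNoetherian f₀
  haveI : IsIntegral X' := hf.isIntegral hJne
  exact ⟨X', f, J, hf, hJne, hJ, inferInstance, hf.isProper, F, hF, hFcl, hreg⟩

/-! ## §3 The `offFinite` shape of res-L1-w45a-lead-1's interface I-A, discharged on fourfolds -/

/-- **THEOREM A on fourfolds in the EXACT ∃-shape of `DesingularizationOffClosedPoints.desingularization_offFinite_of_local`** (res-L1-w45a-lead-1's
interface I-A, 23:01:12Z), so that the chain's file 4 (`…FiniteResidualOfFourfold`, res-L1-w45a-stub-2) instantiates on fourfolds from p557070 directly: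
a blowing up `f : X' → X` along `J` with `Supp J ⊆ (Reg X)ᶜ`, and a closed FINITE set `F` of closed points with `X'` regular off `f⁻¹ F`.
Modulo CP 2019 Thm. 1.1, Raynaud–Gruson 5.2.2, CP 2019 Prop. 4.4 BY NAME. [OURS · conditional-result]
[folklore assembly; cite: Temkin2008, Prop. 2.3.4] [cite: CossartPiltant2019, Thm. 1.1 (i)(ii); Prop. 4.4] -/
theorem exists_isBlowup_regular_offFinite
    (hG : CossartPiltant2019General.{0}) (h081R : Stacks081R.{0}) (hP : CossartPiltant2019Principalization.{0})
    {k : Type} [Field k] {X : Scheme.{0}} (f₀ : X ⟶ Spec (.of k)) [IsIntegral X] [LocallyOfFiniteType f₀] [QuasiCompact f₀]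
    (h4 : topologicalKrullDim X = 4) :
    ∃ (X' : Scheme.{0}) (f : X' ⟶ X) (J : X.IdealSheafData) (F : Set X), IsBlowup f J ∧
      (J.support : Set X) ⊆ (Scheme.regularLocus X)ᶜ ∧ IsClosed F ∧ F.Finite ∧ (∀ b ∈ F, IsClosed ({b} : Set X)) ∧
      ∀ x' : X', f x' ∉ F → x' ∈ Scheme.regularLocus X' := by
  obtain ⟨X', f, J, hf, -, hJ, F, hF, hFcl, hreg⟩ := exists_isBlowup_regular_off_finite_closedPoints hG h081R hP f₀ h4
  have hFc : IsClosed F := by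
    rw [← Set.biUnion_of_singleton F]
    exact hF.isClosed_biUnion fun b hb => hFcl b hb
  exact ⟨X', f, J, F, hf, hJ, hFc, hF, hFcl, fun x' hx' => (Scheme.mem_regularLocus (X := X') x').mpr (hreg x' hx')⟩

/-- The same with `J ≠ ⊥`, `X'` integral and `f` proper recorded (the binders FC″-consumers want). [OURS · conditional-result]
[cite: Temkin2008, Prop. 2.3.4] [cite: CossartPiltant2019, Thm. 1.1 (i)(ii); Prop. 4.4] -/
theorem exists_isBlowup_regular_offFinite'
    (hG : CossartPiltant2019General.{0}) (h081R : Stacks081R.{0}) (hP : CossartPiltant2019Principalization.{0})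
    {k : Type} [Field k] {X : Scheme.{0}} (f₀ : X ⟶ Spec (.of k)) [IsIntegral X] [LocallyOfFiniteType f₀] [QuasiCompact f₀]
    (h4 : topologicalKrullDim X = 4) :
    ∃ (X' : Scheme.{0}) (f : X' ⟶ X) (J : X.IdealSheafData) (F : Set X), IsBlowup f J ∧ J ≠ ⊥ ∧ IsIntegral X' ∧ IsProper f ∧
      (J.support : Set X) ⊆ (Scheme.regularLocus X)ᶜ ∧ IsClosed F ∧ F.Finite ∧ (∀ b ∈ F, IsClosed ({b} : Set X)) ∧
      ∀ x' : X', f x' ∉ F → x' ∈ Scheme.regularLocus X' := by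
  obtain ⟨X', f, J, hf, hJne, hJ, F, hF, hFcl, hreg⟩ := exists_isBlowup_regular_off_finite_closedPoints hG h081R hP f₀ h4
  haveI : IsLocallyNoetherian X := LocallyOfFiniteType.isLocallyNoetherian f₀
  haveI : IsIntegral X' := hf.isIntegral hJne
  have hFc : IsClosed F := by
    rw [← Set.biUnion_of_singleton F]
    exact hF.isClosed_biUnion fun b hb => hFcl b hb
  exact ⟨X', f, J, F, hf, hJne, inferInstance, hf.isProper, hJ, hFc, hF, hFcl,
    fun x' hx' => (Scheme.mem_regularLocus (X := X') x').mpr (hreg x' hx')⟩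

end Summit.ResolutionOfSingularities.ResolutionOfSingularities.Theorems.FInjectiveMacaulayfication.TerminationModClosedPoints

end
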